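import Mathlib.Logic.Relation
import Mathlib.LinearAlgebra.BilinearForm.Properties
import Literature.AlgebraicGeometry.HodgeTheory.LocallyTrivialExtensionClasses

/-!
# Route LinearSystemTorelli — crux `LocalTubeSpan`: unimodular chains of vanishing cycles

Helper file (`--supports stmt-HodgeConjecture-2490`, line `Sketch`, stub `stub_unimodularChain`).
The crux ("local Schnell theorem", [Schnell2010] §7) concerns a local monodromy group `⟨s₁⟩ ≤ G`
acting on the vanishing cohomology `V` (a `ℚ`-representation `A`, alternating intersection form
`B`) through the Picard–Lefschetz transvections `T_δ(x) = x - B(x, δ) δ` along the vanishing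
cycles `δ = e(t)` of the local meridians `t ∈ s₁`.  The orbit-detection theorems of the line need
the generator cycles to lie in ONE `⟨s₁⟩`-orbit; this file supplies that from the local Dynkin
diagram (the graph on `s₁` with an edge `t ∼ t'` whenever `B(e_t, e_{t'}) = ±1`,
[Janssen1983] §2): generators joined by a chain of unimodular edges have cycles in one orbit.

* `localTubeSpan_apply_mul_apply_eq_of_pairing_eq_one` — one edge, the braid move: if
  `B(e_a, e_b) = 1` then `T_b (T_a (e_b)) = e_a` (`T_a e_b = e_b + e_a` by skew-symmetry, and
  `T_b (e_b + e_a) = e_b + e_a - B(e_a, e_b) e_b = e_a`);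
* `localTubeSpan_exists_apply_eq_of_unimodularEdge` — hence `e_b ∈ ⟨s₁⟩ · e_a` for every
  unimodular edge (`(b a)⁻¹` if the pairing is `1`, `a b` if it is `-1`);
* `localTubeSpan_exists_apply_eq_of_unimodularChain` — the registered stub: induction along a
  `Relation.ReflTransGen` chain of unimodular edges.

Elementary linear algebra over `ℚ`; no named facts.

References: [Schnell2010] C. Schnell, *Primitive cohomology and the tube mapping*, Math. Z. 268
(2010), §7 (skew-symmetric vanishing lattices of hypersurface singularities / Lefschetz pencils);
[Janssen1983] W. A. M. Janssen, *Skew-symmetric vanishing lattices and their monodromy groups*,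
Math. Ann. 266 (1983) (the Dynkin diagram of a vanishing lattice and the transitivity of the
monodromy group on a connected basis).
-/

-- `Summit.HodgeConjecture.HodgeConjecture.Theorems` is the mandated namespace (single-conjunct
-- summit: Sub = Summit), which `linter.dupNamespace` flags on every declaration; the lakefile turns
-- the linter off tree-wide (weak option), restated here so stand-alone elaboration is warning-free.
set_option linter.dupNamespace false

noncomputable section

open CategoryTheory groupCohomology
open Literature.AlgebraicGeometry.HodgeTheory

namespace Summit.HodgeConjecture.HodgeConjecture.Theorems

section Edge

variable {G : Type} [Group G] (A : Rep.{0} ℚ G)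

/-- **The braid move on one unimodular edge.**  If the generators `a, b ∈ s₁` act as the
transvections along `e_a, e_b` of an alternating form with `B(e_a, e_b) = 1`, then
`(b a) · e_b = e_a`: indeed `T_a e_b = e_b - B(e_b, e_a) e_a = e_b + e_a` and
`T_b (e_b + e_a) = e_b + e_a - (B(e_b, e_b) + B(e_a, e_b)) e_b = e_a`. [folklore] -/
theorem localTubeSpan_apply_mul_apply_eq_of_pairing_eq_one (B : LinearMap.BilinForm ℚ A.V)
    (hB : B.IsAlt) (s₁ : Set G) (e : G → A.V)
    (hPL : ∀ t ∈ s₁, ∀ x : A.V, A.ρ t x = x - B x (e t) • e t) {a b : G} (ha : a ∈ s₁)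
    (hb : b ∈ s₁) (hab : B (e a) (e b) = 1) : A.ρ (b * a) (e b) = e a := by
  have hba : B (e b) (e a) = -1 := by rw [← hB.neg_eq, hab]
  have hbb : B (e b) (e b) = 0 := hB.self_eq_zero _
  rw [map_mul, Module.End.mul_apply, hPL a ha, hPL b hb, hba, neg_one_smul, sub_neg_eq_add,
    map_add, LinearMap.add_apply, hbb, hab, zero_add, one_smul, add_sub_cancel_left]

/-- **One unimodular edge.**  If `a, b ∈ s₁` act as transvections along `e_a, e_b` of an
alternating form and `B(e_a, e_b) = ±1`, then `e_b` lies in the `⟨s₁⟩`-orbit of `e_a`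
(by the braid move: `(b a)⁻¹ · e_a = e_b` if the pairing is `1`, `(a b) · e_a = e_b` if it is
`-1`). [folklore] -/
theorem localTubeSpan_exists_apply_eq_of_unimodularEdge (B : LinearMap.BilinForm ℚ A.V)
    (hB : B.IsAlt) (s₁ : Set G) (e : G → A.V)
    (hPL : ∀ t ∈ s₁, ∀ x : A.V, A.ρ t x = x - B x (e t) • e t) {a b : G} (ha : a ∈ s₁)
    (hb : b ∈ s₁) (hab : B (e a) (e b) = 1 ∨ B (e a) (e b) = -1) :
    ∃ g ∈ Subgroup.closure s₁, A.ρ g (e a) = e b := by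
  rcases hab with hab | hab
  · refine ⟨(b * a)⁻¹, inv_mem (mul_mem (Subgroup.subset_closure hb)
      (Subgroup.subset_closure ha)), ?_⟩
    conv_lhs => rw [← localTubeSpan_apply_mul_apply_eq_of_pairing_eq_one A B hB s₁ e hPL ha hb hab]
    rw [← Module.End.mul_apply, ← map_mul, inv_mul_cancel, map_one, Module.End.one_apply]
  · have hba : B (e b) (e a) = 1 := by rw [← hB.neg_eq, hab, neg_neg]
    exact ⟨a * b, mul_mem (Subgroup.subset_closure ha) (Subgroup.subset_closure hb),
      localTubeSpan_apply_mul_apply_eq_of_pairing_eq_one A B hB s₁ e hPL hb ha hba⟩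

end Edge

/-- **Unimodular chains** (the registered stub `stub_unimodularChain`).  If the generators
`t ∈ s₁` act as transvections `x ↦ x - B(x, e_t) e_t` of an alternating form and `t, t'` are
joined by a chain of generators whose consecutive cycles pair to `±1` (a path in the local Dynkin
diagram), then `e_{t'}` lies in the `⟨s₁⟩`-orbit of `e_t`.  In particular the cycles of a
connected Dynkin diagram form part of a single orbit of the local monodromy group.
[cite: Schnell2010, §7] -/
theorem localTubeSpan_exists_apply_eq_of_unimodularChain {G : Type} [Group G] (A : Rep.{0} ℚ G)
    (B : LinearMap.BilinForm ℚ A.V) (hB : B.IsAlt) (s₁ : Set G)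
    (e : G → A.V) (hPL : ∀ t ∈ s₁, ∀ x : A.V, A.ρ t x = x - B x (e t) • e t) {t t' : G}
    (h : Relation.ReflTransGen
      (fun a b : G => a ∈ s₁ ∧ b ∈ s₁ ∧ (B (e a) (e b) = 1 ∨ B (e a) (e b) = -1)) t t') :
    ∃ g ∈ Subgroup.closure s₁, A.ρ g (e t) = e t' := by
  induction h with
  | refl => exact ⟨1, one_mem _, by rw [map_one, Module.End.one_apply]⟩
  | tail _ hbc ih =>
    obtain ⟨ha, hb, hab⟩ := hbc
    obtain ⟨g, hg, hgt⟩ := ih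
    obtain ⟨g', hg', hg't⟩ :=
      localTubeSpan_exists_apply_eq_of_unimodularEdge A B hB s₁ e hPL ha hb hab
    exact ⟨g' * g, mul_mem hg' hg, by rw [map_mul, Module.End.mul_apply, hgt, hg't]⟩

end Summit.HodgeConjecture.HodgeConjecture.Theorems

end
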